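import Summits.FinalStateConjecture.FinalStateConjecture.Theses.LaminatedThreshold

/-!
# Crux `LaminatedThreshold` — line `heteroclinic-comb` (crux-strategist, 2026-08-17)

Crux item `stmt-FinalStateConjecture-16893`, decl (FIXED, concluded BY NAME in `LaminatedThreshold_of`):
`Summit.FinalStateConjecture.FinalStateConjecture.Theses.LaminatedThreshold.LaminatedThreshold`
(REFUTATION route `route-FinalStateConjecture-LaminatedThreshold`, crux A; `closes : LaminatedThreshold →
TameExitsLocalise → ¬ FinalStateConjecture`).

## The line: a HETEROCLINIC COMB instead of a chaotic saddle

The route (and line `birth`) obtain the two-sided accumulation of exceptional leaves from an index-`1`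
CHAOTIC invariant set of the renormalised (similarity-time) vacuum flow. This line needs strictly less
dynamics. Transfer (Aichelburg–Bizoń–Tabor, CQG 23 (2006) S299 = arXiv:gr-qc/0512136, §§3–4): in
Einstein–`SU(2)`-σ collapse near the coupling `η_c` one observes along one-parameter families a COMB of
critical parameters `p₁ > p₂ > … → p*`, explained by ONE transverse intersection of the unstable manifold
of the threshold solution (DSS cycle) with the codimension-one stable manifold of a SECOND self-similar
solution (`CSS₁`): the backward images of that stable sheet under the flow accumulate `C¹` on the stable
manifold of the threshold solution — the inclination (λ-) lemma. If BOTH unstable branches of a naked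
threshold solution `S₀` are so captured by stable sheets of naked secondary critical solutions, the
exceptional set near `W^s(S₀)` is a TWO-SIDED comb `W^s(S₀) ∪ ⋃ₙ Lₙ⁺ ∪ ⋃ₙ Lₙ⁻`, which is exactly the
`(Φ, K)`-saturation the crux asks for, with `K = {0} ∪ {±1/(n+1)}` after straightening. No horseshoe,
no Cantor set, no Shil'nikov spectral condition is needed; two transverse heteroclinic orbits suffice
(dimensionally generic once several index-`1` critical solutions coexist — the "competition between
centred and off-centre critical solutions / no universal critical solution" of Baumgarte–Gundlach–
Hilditch 2023 and arXiv:2606.27431 is the vacuum evidence that they may).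

The cut (three registered stubs, the composition `LaminatedThreshold_of` is kernel-checked):

* `stub_combLemma` — THE ABSTRACT COMB LEMMA (pure dynamics on a Banach space `E × ℝ`, Mathlib
  vocabulary only; a THEOREM of hyperbolic dynamics, provable): a `C¹` map `T` near its fixed point `0`
  with derivative `(x, t) ↦ (S x, μ t)`, `‖S‖ < 1 < μ` (one expanding direction), has a radius `r₁` such
  that any two locally `C¹` "seed" hypersurfaces `{G₁ = 0} ∋ (0, σ₁)`, `{G₂ = 0} ∋ (0, σ₂)`, `0 < σ₁ < r₁`,
  `-r₁ < σ₂ < 0`, transverse to the expanding direction (`∂_t Gᵢ ≠ 0`), generate a comb chart: for every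
  `ε > 0` a ball `B_ρ(0)`, a functional `Φ` continuous on it with `Φ 0 = 0`, and `K ∋ 0` accumulating at
  `0` from both sides, such that `Φ p ∈ K` forces the forward `T`-orbit of `p` either to stay in `B_ε(0)`
  for ever (`p` on the local stable manifold) or to hit a seed inside `B_ε((0, σᵢ))` (`p` on a pulled-back
  sheet). Proof route: Hadamard backward graph transform of horizontal graphs (needs only forward
  iterates, so non-invertible `T` is fine), uniform hyperbolicity on a small ball from `C¹`, strict
  ordering and `C⁰` convergence of the sheets to the stable graph, then a piecewise-linear straightening
  in `t` defines `Φ`. (Palis' λ-lemma / stable manifold theorem via graph transform; none of it is in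
  Mathlib — size L in Lean, classical on paper.)
* `stub_vacuumCombCarrier` — THE VACUUM CARRIER (the physics; open-problem): at some admissible datum
  `d⋆` there are a Banach phase space `E × ℝ`, a `C¹` hyperbolic map `T` as above (the similarity-time-`1`
  map of the vacuum flow near a naked critical solution `S₀` in adapted coordinates, one unstable
  direction), a READING MAP `π` from initial data sets to `E × ℝ` with `π d⋆ = 0` which is continuous
  along every compactly supported jointly smooth admissible family through `d⋆` (the gauge-fixed interior
  data in similarity variables depend continuously on the datum), seeds at ALL scales on BOTH sides
  (pull-backs `G ∘ Tᵏ` of two transverse heteroclinic sheets `W^u(S₀)^± ⋔ W^s(S₁^±)` of naked secondary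
  critical solutions), and the DICTIONARY: a small member of such a family whose `π`-orbit stays near `0`
  for ever, or hits a seed, is NAKED — every maximal vacuum Cauchy development carries a visible
  future-incomplete null ray (the inline predicate of `Lines/birth.lean`, `= DataEmbedding.
  IsVisibleIncompleteNullRay`). This is where all the general relativity lives: existence of smooth
  admissible naked data (Rodnianski–Shlapentokh-Rothman 2023 is the frontier), a `C¹` realisation of the
  renormalised vacuum flow on a Banach space of local data, two index-`1` naked critical solutions with
  transverse heteroclinic orbits on both unstable branches, and locality of nakedness under small local
  kicks.
* `stub_nakedNotSettled` — NAKED DEVELOPMENTS ARE EXCEPTIONAL (verbatim the registered stub of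
  `Lines/birth.lean`, SHARED between the two lines; L–XL): a maximal vacuum Cauchy development of an
  admissible datum carrying a visible future-incomplete null ray is not both complete-`𝓘⁺` and settled.

Composition `LaminatedThreshold_of` (no `sorry` of its own): carrier ↦ `(E, T, S, μ, r₀, π, d⋆)`; comb
lemma ↦ `r₁`; carrier's seeds at scale `r₁` ↦ `(σ₁, σ₂, ε₂, G₁, G₂)` with the nakedness dictionary; comb
lemma at `ε := ε₂` ↦ `(ρ, Φ, K)`; the crux's functional is `Φ ∘ π`, its `K` is `K`; continuity along a
local family = `ContinuousOn Φ (ball 0 ρ)` ∘ continuity of `π ∘ F` (radius shrunk so that `π (F c) ∈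
ball 0 ρ`); saturation = comb disjunction ↦ dictionary ↦ naked ↦ (Stub 3) not good; "`d⋆` exceptional" is
read off the constant family (`Φ (π d⋆) = Φ 0 = 0 ∈ K`). Neither stub alone is the crux: Stub 1 is
GR-free, Stub 2 never mentions `𝓘⁺`, charts, Kerr, `Φ` or `K`, Stub 3 produces no datum.

Degenerate instance (recorded, not hidden): with `E = 0` the comb lemma is one-dimensional and the
carrier alone says "the unstable coordinate `π` reads off nakedness at the geometric heights
`σᵢ μ^{-k}`" — a laminated naked threshold with explicit geometric `K`. The comb lemma is load-bearing
exactly in the intended infinite-dimensional realisation (`E` = the stable directions of `S₀`), where it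
is what turns TWO transverse sheets into infinitely many accumulating ones.

## Disproof used
None relevant: no `Cruxes/LaminatedThreshold/Disproof.lean`, no `Theorems/LaminatedThreshold/Negative/`
(`ledger crux ls`: Lines/birth.* only); `ledger negatives --problem FinalStateConjecture` (2026-08-17): one
unrelated refutation (`not_UniformPhotonSphereChannels`). No stub is an instance of it.
-/

noncomputable section

-- the doubled `FinalStateConjecture.FinalStateConjecture` path component trips dupNamespace
set_option linter.dupNamespace false

namespace Summit.FinalStateConjecture.FinalStateConjecture.Cruxes.LaminatedThreshold.HeteroclinicComb

open Set Filter Function Topology TopologicalSpace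
open scoped Manifold ContDiff
open Literature.Geometry.Lorentzian
open Summit.FinalStateConjecture.FinalStateConjecture.Theses.LaminatedThreshold

/-! ## §0 Vocabulary of the proof (NOT used inside stub signatures, which are fully expanded) -/

section Vocabulary

variable {X : Type} [TopologicalSpace X] [ChartedSpace E3 X] [IsManifold (𝓡 3) ∞ X] [T2Space X]
  [SecondCountableTopology X] [ConnectedSpace X]

/-- **Good in the re-typed sense** (verbatim the summit's property at a datum `D`). [cite: DafermosLuk2017, Conjecture 1] -/
def IsGood (D : InitialDataSet (𝓡 3) X) : Prop :=
  (∃ 𝒟 : Literature.Geometry.Lorentzian.VacuumCauchyDevelopment D, 𝒟.IsMaximal) ∧ ∀ 𝒟 : Literature.Geometry.Lorentzian.VacuumCauchyDevelopment D, 𝒟.IsMaximal → Summit.FinalStateConjecture.HasCompleteNullInfinity 𝒟.toCauchyDevelopment ∧ ∃ (O : Set 𝒟.carrier) (d : Literature.Geometry.Lorentzian.FinalStateDecomposition 𝒟.toSpacetime O 2), (∀ i, Literature.Geometry.Lorentzian.Kerr.IsSubextremal (d.mass i) (d.spin i)) ∧ O = Summit.FinalStateConjecture.exteriorOf 𝒟.toCauchyDevelopment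 d.charted ∧ Summit.FinalStateConjecture.RaysStayInClosure 𝒟.toCauchyDevelopment O ∧ Summit.FinalStateConjecture.HasExhaustiveCharts d ∧ Summit.FinalStateConjecture.IsFutureOriented d

/-- **`𝒟` carries a visible future-incomplete null ray** (verbatim the inline predicate of
`Lines/birth.lean`, `= DataEmbedding.IsVisibleIncompleteNullRay`). [cite: HawkingEllis1973CUP, §9.2, p. 311] -/
def HasNakedRay {D : InitialDataSet (𝓡 3) X} (𝒟 : Literature.Geometry.Lorentzian.VacuumCauchyDevelopment D) : Prop :=
  ∀ [𝒟.metric.HasLeviCivita], ∃ (γ : ℝ → 𝒟.carrier) (dom : Set ℝ), (Literature.Geometry.Lorentzian.IsMaximalGeodesicOn 𝒟.metric.leviCivita γ dom ∧ (0 : ℝ) ∈ dom ∧ BddAbove dom ∧ (∀ t ∈ dom, 𝒟.metric.IsNull (Literature.Geometry.Lorentzian.velocity (𝓡 4) γ t) ∧ 𝒟.timeOrientation.IsFutureDirected (Literature.Geometry.Lorentzian.velocity (𝓡 4) γ t)) ∧ (∀ t ∈ dom, 0 ≤ t → (∃ (p : X) (δ : ℝ → 𝒟.carrier) (s : Set ℝ),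 𝒟.metric.IsNormalisedNullRayFrom 𝒟.timeOrientation 𝒟.embed 𝒟.normal p δ s ∧ ¬ BddAbove s ∧ γ t ∈ 𝒟.metric.chronologicalPast 𝒟.timeOrientation (δ '' (s ∩ Set.Ici 0)))))

/-- **Naked datum**: every maximal vacuum Cauchy development of `D` carries a visible future-incomplete
null ray. [folklore] -/
def IsNakedDatum (D : InitialDataSet (𝓡 3) X) : Prop :=
  ∀ 𝒟 : Literature.Geometry.Lorentzian.VacuumCauchyDevelopment D, 𝒟.IsMaximal → HasNakedRay 𝒟

end Vocabulary

/-! ## §1 The three statements of the line (named; nothing here is a route item) -/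

/-- **THE ABSTRACT COMB LEMMA** (`stub_combLemma`; hyperbolic dynamics in a Banach space, one expanding
direction; inclination lemma + straightening). Why plausibly true: it is the backward Hadamard graph
transform (stable-manifold theorem for `C¹` maps, non-invertible allowed) followed by an explicit
piecewise-linear straightening of the strictly ordered, uniformly converging sheets. Why it might fail
as typed: only through a typing slip (e.g. a missing smallness); mathematically classical.
[cite: GrebogiEtAl1983] [cite: McdonaldEtAl1985] -/
def CombLemma : Prop :=
  ∀ (E : Type) [NormedAddCommGroup E] [NormedSpace ℝ E] [CompleteSpace E] (T : E × ℝ → E × ℝ) (S : E →L[ℝ] E) (μ r₀ : ℝ), T 0 = 0 → 0 < r₀ → ContDiffOn ℝ 1 T (Metric.ball 0 r₀) → HasFDerivAt T ((S.comp (ContinuousLinearMap.fst ℝ E ℝ)).prod (μ • ContinuousLinearMap.snd ℝ E ℝ)) 0 → ‖S‖ < 1 → 1 < μ → ∃ r₁ : ℝ, 0 < r₁ ∧ ∀ (σ₁ σ₂ : ℝ) (G₁ G₂ : E × ℝ → ℝ), 0 < σ₁ ∧ σ₁ < r₁ ∧ -r₁ < σ₂ ∧ σ₂ < 0 ∧ (∃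 r' : ℝ, 0 < r' ∧ ContDiffOn ℝ 1 G₁ (Metric.ball ((0 : E), σ₁) r') ∧ ContDiffOn ℝ 1 G₂ (Metric.ball ((0 : E), σ₂) r')) ∧ G₁ ((0 : E), σ₁) = 0 ∧ fderiv ℝ G₁ ((0 : E), σ₁) ((0 : E), (1 : ℝ)) ≠ 0 ∧ G₂ ((0 : E), σ₂) = 0 ∧ fderiv ℝ G₂ ((0 : E), σ₂) ((0 : E), (1 : ℝ)) ≠ 0 → ∀ ε : ℝ, 0 < ε → ∃ ρ : ℝ, 0 < ρ ∧ ∃ (Φ : E × ℝ → ℝ) (K : Set ℝ), Φ 0 = 0 ∧ (0 : ℝ) ∈ K ∧ (∀ η : ℝ, 0 < η → (K ∩ Set.Ioo (0 - η) 0).Nonempty ∧ (K ∩ Set.Ioo 0 (0 + η)).Nonempty) ∧ ContinuousOn Φ (Metric.ball 0 ρ) ∧ ∀ p ∈ Metric.ball (0 : E × ℝ) ρ, Φ p ∈ K → ((∀ n : ℕ, T^[n] (p) ∈ Metric.ball (0 : E × ℝ) ε) ∨ (∃ n : ℕ, T^[n] (p) ∈ Metric.ball ((0 : E), σ₁) ε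 ∧ G₁ (T^[n] (p)) = 0) ∨ (∃ n : ℕ, T^[n] (p) ∈ Metric.ball ((0 : E), σ₂) ε ∧ G₂ (T^[n] (p)) = 0))

/-- **THE VACUUM COMB CARRIER** (`stub_vacuumCombCarrier`; open-problem): see the module docstring.
Why plausibly true: Aichelburg–Bizoń–Tabor's observed comb in σ-model collapse (one transverse
heteroclinic sheet suffices per side), several coexisting approximately-DSS vacuum critical solutions
(Baumgarte–Gundlach–Hilditch 2023; arXiv:2606.27431), eternally critical data being naked. Why it might
fail: (i) the subcritical branch of a threshold solution may never be captured by a naked secondary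
critical solution (then the comb is one-sided, as in the σ-model, and Christodoulou curves tangent to the
leaf escape); (ii) no smooth admissible naked vacuum datum is known; (iii) the renormalised vacuum flow
may not be realisable as a `C¹` map on a fixed Banach space (quasilinear derivative loss).
[cite: BaumgarteEtAl2023] [cite: HawkingEllis1973CUP, §9.2, p. 311] -/
def VacuumCombCarrier : Prop :=
  ∃ (X : Type) (_ : TopologicalSpace X) (_ : ChartedSpace Literature.Geometry.Lorentzian.E3 X) (_ : IsManifold (𝓡 3) ((⊤ : ℕ∞) : WithTop ℕ∞) X) (_ : T2Space X) (_ : SecondCountableTopology X) (_ : ConnectedSpace X) (dstar : Literature.Geometry.Lorentzian.InitialDataSet (𝓡 3) X) (E : Type) (_ : NormedAddCommGroup E) (_ : NormedSpace ℝ E) (_ : CompleteSpace E) (T : E × ℝ → E × ℝ) (S : E →L[ℝ] E) (μ r₀ : ℝ) (π : Literature.Geometry.Lorentzian.InitialDataSet (𝓡 3) X → E × ℝ), dstar ∈ Literature.Geometry.Lorentzian.admissibleVacuumData X ∧ T 0 = 0 ∧ 0 < r₀ ∧ ContDiffOn ℝ 1 T (Metric.ball 0 r₀) ∧ HasFDerivAt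 T ((S.comp (ContinuousLinearMap.fst ℝ E ℝ)).prod (μ • ContinuousLinearMap.snd ℝ E ℝ)) 0 ∧ ‖S‖ < 1 ∧ 1 < μ ∧ π dstar = 0 ∧ (∀ F : EuclideanSpace ℝ (Fin 1) → Literature.Geometry.Lorentzian.InitialDataSet (𝓡 3) X, Literature.Geometry.Lorentzian.InitialDataSet.IsSmoothDataFamily 1 F → F 0 = dstar → (∀ c, F c ∈ Literature.Geometry.Lorentzian.admissibleVacuumData X) → (∃ C : Set X, IsCompact C ∧ ∀ c, ∀ x ∉ C, (F c).h.inner x = dstar.h.inner x ∧ (F c).k x = dstar.k x) → ∃ δ : ℝ, 0 < δ ∧ ContinuousOn (fun c ↦ π (F c)) (Metric.ball 0 δ)) ∧ ∀ r : ℝ, 0 < r → ∃ (σ₁ σ₂ ε₂ : ℝ) (G₁ G₂ : E × ℝ → ℝ), 0 < ε₂ ∧ (0 < σ₁ ∧ σ₁ < r ∧ -r < σ₂ ∧ σ₂ < 0 ∧ (∃ r' : ℝ, 0 < r' ∧ ContDiffOn ℝ 1 G₁ (Metric.ball ((0 : E), σ₁) r') ∧ ContDiffOn ℝ 1 G₂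 (Metric.ball ((0 : E), σ₂) r')) ∧ G₁ ((0 : E), σ₁) = 0 ∧ fderiv ℝ G₁ ((0 : E), σ₁) ((0 : E), (1 : ℝ)) ≠ 0 ∧ G₂ ((0 : E), σ₂) = 0 ∧ fderiv ℝ G₂ ((0 : E), σ₂) ((0 : E), (1 : ℝ)) ≠ 0) ∧ ∀ F : EuclideanSpace ℝ (Fin 1) → Literature.Geometry.Lorentzian.InitialDataSet (𝓡 3) X, Literature.Geometry.Lorentzian.InitialDataSet.IsSmoothDataFamily 1 F → F 0 = dstar → (∀ c, F c ∈ Literature.Geometry.Lorentzian.admissibleVacuumData X) → (∃ C : Set X, IsCompact C ∧ ∀ c, ∀ x ∉ C, (F c).h.inner x = dstar.h.inner x ∧ (F c).k x = dstar.k x) → ∃ δ : ℝ, 0 < δ ∧ ∀ c ∈ Metric.ball (0 : EuclideanSpace ℝ (Fin 1)) δ, ((∀ n : ℕ, T^[n] (π (F c)) ∈ Metric.ball (0 : E × ℝ) ε₂) ∨ (∃ n : ℕ, T^[n] (π (F c)) ∈ Metric.ball ((0 : E), σ₁) ε₂ ∧ G₁ (T^[n] (π (F c))) = 0) ∨ (∃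 n : ℕ, T^[n] (π (F c)) ∈ Metric.ball ((0 : E), σ₂) ε₂ ∧ G₂ (T^[n] (π (F c))) = 0)) → ∀ 𝒟 : Literature.Geometry.Lorentzian.VacuumCauchyDevelopment (F c), 𝒟.IsMaximal → ∀ [𝒟.metric.HasLeviCivita], ∃ (γ : ℝ → 𝒟.carrier) (dom : Set ℝ), (Literature.Geometry.Lorentzian.IsMaximalGeodesicOn 𝒟.metric.leviCivita γ dom ∧ (0 : ℝ) ∈ dom ∧ BddAbove dom ∧ (∀ t ∈ dom, 𝒟.metric.IsNull (Literature.Geometry.Lorentzian.velocity (𝓡 4) γ t) ∧ 𝒟.timeOrientation.IsFutureDirected (Literature.Geometry.Lorentzian.velocity (𝓡 4) γ t)) ∧ (∀ t ∈ dom, 0 ≤ t → (∃ (p : X) (δ' : ℝ → 𝒟.carrier) (s : Set ℝ), 𝒟.metric.IsNormalisedNullRayFrom 𝒟.timeOrientation 𝒟.embed 𝒟.normal p δ' s ∧ ¬ BddAbove s ∧ γ t ∈ 𝒟.metric.chronologicalPast 𝒟.timeOrientation (δ' '' (s ∩ Set.Ici 0)))))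

/-- **NAKED DEVELOPMENTS ARE EXCEPTIONAL FOR THE FINAL-STATE PROPERTY** (`stub_nakedNotSettled`;
verbatim the registered stub of `Lines/birth.lean`, shared). [cite: HawkingEllis1973CUP, §9.2, Prop. 9.2.1] [cite: DafermosLuk2017, Conjecture 1] -/
def NakedNotSettled : Prop :=
  ∀ (X : Type) [TopologicalSpace X] [ChartedSpace Literature.Geometry.Lorentzian.E3 X] [IsManifold (𝓡 3) ((⊤ : ℕ∞) : WithTop ℕ∞) X] [T2Space X] [SecondCountableTopology X] [ConnectedSpace X], ∀ D ∈ Literature.Geometry.Lorentzian.admissibleVacuumData X, ∀ 𝒟 : Literature.Geometry.Lorentzian.VacuumCauchyDevelopment D, 𝒟.IsMaximal → (∀ [𝒟.metric.HasLeviCivita], ∃ (γ : ℝ → 𝒟.carrier) (dom : Set ℝ), (Literature.Geometry.Lorentzian.IsMaximalGeodesicOn 𝒟.metric.leviCivita γ dom ∧ (0 : ℝ) ∈ dom ∧ BddAbove dom ∧ (∀ t ∈ dom, 𝒟.metric.IsNull (Literature.Geometry.Lorentzian.velocity (𝓡 4) γ t) ∧ 𝒟.timeOrientation.IsFutureDirected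 (Literature.Geometry.Lorentzian.velocity (𝓡 4) γ t)) ∧ (∀ t ∈ dom, 0 ≤ t → (∃ (p : X) (δ' : ℝ → 𝒟.carrier) (s : Set ℝ), 𝒟.metric.IsNormalisedNullRayFrom 𝒟.timeOrientation 𝒟.embed 𝒟.normal p δ' s ∧ ¬ BddAbove s ∧ γ t ∈ 𝒟.metric.chronologicalPast 𝒟.timeOrientation (δ' '' (s ∩ Set.Ici 0)))))) → ¬ (Summit.FinalStateConjecture.HasCompleteNullInfinity 𝒟.toCauchyDevelopment ∧ ∃ (O : Set 𝒟.carrier) (d : Literature.Geometry.Lorentzian.FinalStateDecomposition 𝒟.toSpacetime O 2), (∀ i, Literature.Geometry.Lorentzian.Kerr.IsSubextremal (d.mass i) (d.spin i)) ∧ O = Summit.FinalStateConjecture.exteriorOf 𝒟.toCauchyDevelopment d.charted ∧ Summit.FinalStateConjecture.RaysStayInClosure 𝒟.toCauchyDevelopment O ∧ Summit.FinalStateConjecture.HasExhaustiveCharts d ∧ Summit.FinalStateConjecture.IsFutureOriented d)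

/-! ### Statements of the registered stubs, under the stub names -/
namespace Goal

/-- Statement of `stub_combLemma`. -/
abbrev stub_combLemma : Prop := CombLemma
/-- Statement of `stub_vacuumCombCarrier`. -/
abbrev stub_vacuumCombCarrier : Prop := VacuumCombCarrier
/-- Statement of `stub_nakedNotSettled`. -/
abbrev stub_nakedNotSettled : Prop := NakedNotSettled

end Goal

/-! ## §2 Registered stubs (the three `sorry`s of the file), stated EXPANDED over existing declarations -/

/-- **Stub 1** (L; classical dynamics): the abstract comb lemma — see `CombLemma`.
[cite: GrebogiEtAl1983] [cite: McdonaldEtAl1985] -/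
theorem stub_combLemma :
    ∀ (E : Type) [NormedAddCommGroup E] [NormedSpace ℝ E] [CompleteSpace E] (T : E × ℝ → E × ℝ) (S : E →L[ℝ] E) (μ r₀ : ℝ), T 0 = 0 → 0 < r₀ → ContDiffOn ℝ 1 T (Metric.ball 0 r₀) → HasFDerivAt T ((S.comp (ContinuousLinearMap.fst ℝ E ℝ)).prod (μ • ContinuousLinearMap.snd ℝ E ℝ)) 0 → ‖S‖ < 1 → 1 < μ → ∃ r₁ : ℝ, 0 < r₁ ∧ ∀ (σ₁ σ₂ : ℝ) (G₁ G₂ : E × ℝ → ℝ), 0 < σ₁ ∧ σ₁ < r₁ ∧ -r₁ < σ₂ ∧ σ₂ < 0 ∧ (∃ r' : ℝ, 0 < r' ∧ ContDiffOn ℝ 1 G₁ (Metric.ball ((0 : E), σ₁) r') ∧ ContDiffOn ℝ 1 G₂ (Metric.ball ((0 : E), σ₂) r')) ∧ G₁ ((0 : E), σ₁) = 0 ∧ fderiv ℝ G₁ ((0 : E), σ₁) ((0 : E), (1 : ℝ)) ≠ 0 ∧ G₂ ((0 : E), σ₂) = 0 ∧ fderiv ℝ G₂ ((0 : E), σ₂)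 ((0 : E), (1 : ℝ)) ≠ 0 → ∀ ε : ℝ, 0 < ε → ∃ ρ : ℝ, 0 < ρ ∧ ∃ (Φ : E × ℝ → ℝ) (K : Set ℝ), Φ 0 = 0 ∧ (0 : ℝ) ∈ K ∧ (∀ η : ℝ, 0 < η → (K ∩ Set.Ioo (0 - η) 0).Nonempty ∧ (K ∩ Set.Ioo 0 (0 + η)).Nonempty) ∧ ContinuousOn Φ (Metric.ball 0 ρ) ∧ ∀ p ∈ Metric.ball (0 : E × ℝ) ρ, Φ p ∈ K → ((∀ n : ℕ, T^[n] (p) ∈ Metric.ball (0 : E × ℝ) ε) ∨ (∃ n : ℕ, T^[n] (p) ∈ Metric.ball ((0 : E), σ₁) ε ∧ G₁ (T^[n] (p)) = 0) ∨ (∃ n : ℕ, T^[n] (p) ∈ Metric.ball ((0 : E), σ₂) ε ∧ G₂ (T^[n] (p)) = 0)) := by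
  sorry

/-- **Stub 2** (open-problem): the vacuum comb carrier — see `VacuumCombCarrier`.
[cite: BaumgarteEtAl2023] [cite: HawkingEllis1973CUP, §9.2, p. 311] -/
theorem stub_vacuumCombCarrier :
    ∃ (X : Type) (_ : TopologicalSpace X) (_ : ChartedSpace Literature.Geometry.Lorentzian.E3 X) (_ : IsManifold (𝓡 3) ((⊤ : ℕ∞) : WithTop ℕ∞) X) (_ : T2Space X) (_ : SecondCountableTopology X) (_ : ConnectedSpace X) (dstar : Literature.Geometry.Lorentzian.InitialDataSet (𝓡 3) X) (E : Type) (_ : NormedAddCommGroup E) (_ : NormedSpace ℝ E) (_ : CompleteSpace E) (T : E × ℝ → E × ℝ) (S : E →L[ℝ] E) (μ r₀ : ℝ) (π : Literature.Geometry.Lorentzian.InitialDataSet (𝓡 3) X → E × ℝ), dstar ∈ Literature.Geometry.Lorentzian.admissibleVacuumData X ∧ T 0 = 0 ∧ 0 < r₀ ∧ ContDiffOn ℝ 1 T (Metric.ball 0 r₀) ∧ HasFDerivAt T ((S.comp (ContinuousLinearMap.fst ℝ E ℝ)).prod (μ • ContinuousLinearMap.snd ℝ E ℝ)) 0 ∧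 ‖S‖ < 1 ∧ 1 < μ ∧ π dstar = 0 ∧ (∀ F : EuclideanSpace ℝ (Fin 1) → Literature.Geometry.Lorentzian.InitialDataSet (𝓡 3) X, Literature.Geometry.Lorentzian.InitialDataSet.IsSmoothDataFamily 1 F → F 0 = dstar → (∀ c, F c ∈ Literature.Geometry.Lorentzian.admissibleVacuumData X) → (∃ C : Set X, IsCompact C ∧ ∀ c, ∀ x ∉ C, (F c).h.inner x = dstar.h.inner x ∧ (F c).k x = dstar.k x) → ∃ δ : ℝ, 0 < δ ∧ ContinuousOn (fun c ↦ π (F c)) (Metric.ball 0 δ)) ∧ ∀ r : ℝ, 0 < r → ∃ (σ₁ σ₂ ε₂ : ℝ) (G₁ G₂ : E × ℝ → ℝ), 0 < ε₂ ∧ (0 < σ₁ ∧ σ₁ < r ∧ -r < σ₂ ∧ σ₂ < 0 ∧ (∃ r' : ℝ, 0 < r' ∧ ContDiffOn ℝ 1 G₁ (Metric.ball ((0 : E), σ₁) r') ∧ ContDiffOn ℝ 1 G₂ (Metric.ball ((0 : E), σ₂) r')) ∧ G₁ ((0 : E), σ₁) = 0 ∧ fderiv ℝ G₁ ((0 : E),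 σ₁) ((0 : E), (1 : ℝ)) ≠ 0 ∧ G₂ ((0 : E), σ₂) = 0 ∧ fderiv ℝ G₂ ((0 : E), σ₂) ((0 : E), (1 : ℝ)) ≠ 0) ∧ ∀ F : EuclideanSpace ℝ (Fin 1) → Literature.Geometry.Lorentzian.InitialDataSet (𝓡 3) X, Literature.Geometry.Lorentzian.InitialDataSet.IsSmoothDataFamily 1 F → F 0 = dstar → (∀ c, F c ∈ Literature.Geometry.Lorentzian.admissibleVacuumData X) → (∃ C : Set X, IsCompact C ∧ ∀ c, ∀ x ∉ C, (F c).h.inner x = dstar.h.inner x ∧ (F c).k x = dstar.k x) → ∃ δ : ℝ, 0 < δ ∧ ∀ c ∈ Metric.ball (0 : EuclideanSpace ℝ (Fin 1)) δ, ((∀ n : ℕ, T^[n] (π (F c)) ∈ Metric.ball (0 : E × ℝ) ε₂) ∨ (∃ n : ℕ, T^[n] (π (F c)) ∈ Metric.ball ((0 : E), σ₁) ε₂ ∧ G₁ (T^[n] (π (F c))) = 0) ∨ (∃ n : ℕ, T^[n] (π (F c)) ∈ Metric.ball ((0 : E), σ₂) ε₂ ∧ G₂ (T^[n] (π (F c)))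 = 0)) → ∀ 𝒟 : Literature.Geometry.Lorentzian.VacuumCauchyDevelopment (F c), 𝒟.IsMaximal → ∀ [𝒟.metric.HasLeviCivita], ∃ (γ : ℝ → 𝒟.carrier) (dom : Set ℝ), (Literature.Geometry.Lorentzian.IsMaximalGeodesicOn 𝒟.metric.leviCivita γ dom ∧ (0 : ℝ) ∈ dom ∧ BddAbove dom ∧ (∀ t ∈ dom, 𝒟.metric.IsNull (Literature.Geometry.Lorentzian.velocity (𝓡 4) γ t) ∧ 𝒟.timeOrientation.IsFutureDirected (Literature.Geometry.Lorentzian.velocity (𝓡 4) γ t)) ∧ (∀ t ∈ dom, 0 ≤ t → (∃ (p : X) (δ' : ℝ → 𝒟.carrier) (s : Set ℝ), 𝒟.metric.IsNormalisedNullRayFrom 𝒟.timeOrientation 𝒟.embed 𝒟.normal p δ' s ∧ ¬ BddAbove s ∧ γ t ∈ 𝒟.metric.chronologicalPast 𝒟.timeOrientation (δ' '' (s ∩ Set.Ici 0))))) := by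
  sorry

/-- **Stub 3** (L–XL; shared with `Lines/birth.lean`): naked developments are exceptional — see
`NakedNotSettled`. [cite: HawkingEllis1973CUP, §9.2, Prop. 9.2.1] [cite: DafermosLuk2017, Conjecture 1] -/
theorem stub_nakedNotSettled :
    ∀ (X : Type) [TopologicalSpace X] [ChartedSpace Literature.Geometry.Lorentzian.E3 X] [IsManifold (𝓡 3) ((⊤ : ℕ∞) : WithTop ℕ∞) X] [T2Space X] [SecondCountableTopology X] [ConnectedSpace X], ∀ D ∈ Literature.Geometry.Lorentzian.admissibleVacuumData X, ∀ 𝒟 : Literature.Geometry.Lorentzian.VacuumCauchyDevelopment D, 𝒟.IsMaximal → (∀ [𝒟.metric.HasLeviCivita], ∃ (γ : ℝ → 𝒟.carrier) (dom : Set ℝ), (Literature.Geometry.Lorentzian.IsMaximalGeodesicOn 𝒟.metric.leviCivita γ dom ∧ (0 : ℝ) ∈ dom ∧ BddAbove dom ∧ (∀ t ∈ dom, 𝒟.metric.IsNull (Literature.Geometry.Lorentzian.velocity (𝓡 4) γ t) ∧ 𝒟.timeOrientation.IsFutureDirected (Literature.Geometry.Lorentzian.velocity (𝓡 4) γ t))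 ∧ (∀ t ∈ dom, 0 ≤ t → (∃ (p : X) (δ' : ℝ → 𝒟.carrier) (s : Set ℝ), 𝒟.metric.IsNormalisedNullRayFrom 𝒟.timeOrientation 𝒟.embed 𝒟.normal p δ' s ∧ ¬ BddAbove s ∧ γ t ∈ 𝒟.metric.chronologicalPast 𝒟.timeOrientation (δ' '' (s ∩ Set.Ici 0)))))) → ¬ (Summit.FinalStateConjecture.HasCompleteNullInfinity 𝒟.toCauchyDevelopment ∧ ∃ (O : Set 𝒟.carrier) (d : Literature.Geometry.Lorentzian.FinalStateDecomposition 𝒟.toSpacetime O 2), (∀ i, Literature.Geometry.Lorentzian.Kerr.IsSubextremal (d.mass i) (d.spin i)) ∧ O = Summit.FinalStateConjecture.exteriorOf 𝒟.toCauchyDevelopment d.charted ∧ Summit.FinalStateConjecture.RaysStayInClosure 𝒟.toCauchyDevelopment O ∧ Summit.FinalStateConjecture.HasExhaustiveCharts d ∧ Summit.FinalStateConjecture.IsFutureOriented d) := by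
  sorry

/-! ## §3 The composition (kernel-checked; no `sorry` of its own) -/

section Composition

variable {X : Type} [TopologicalSpace X] [ChartedSpace E3 X] [IsManifold (𝓡 3) ∞ X] [T2Space X]
  [SecondCountableTopology X] [ConnectedSpace X]

/-- Under Stub 3, a NAKED admissible datum is EXCEPTIONAL (not good). [folklore] -/
theorem not_isGood_of_isNakedDatum (hN : NakedNotSettled) {D : InitialDataSet (𝓡 3) X}
    (hD : D ∈ admissibleVacuumData X) (hnaked : IsNakedDatum D) : ¬ IsGood D := by
  rintro ⟨⟨𝒟, h𝒟⟩, hall⟩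
  exact hN X D hD 𝒟 h𝒟 (hnaked 𝒟 h𝒟) (hall 𝒟 h𝒟)

end Composition

/-- **THE CRUX BY NAME** from the three registered stubs. [folklore] -/
theorem LaminatedThreshold_of :
    Goal.stub_combLemma → Goal.stub_vacuumCombCarrier → Goal.stub_nakedNotSettled →
      LaminatedThreshold := by
  intro hL hC hN
  obtain ⟨X, i₁, i₂, i₃, i₄, i₅, i₆, dstar, E, j₁, j₂, j₃, T, S, μ, r₀, π, hadm, hT0, hr₀, hT1, hTA, hS,
    hμ, hπ0, hcont, hseed⟩ := hC
  -- naked ⇒ exceptional at every admissible datum of `X`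
  have key : ∀ D ∈ admissibleVacuumData X, IsNakedDatum D → ¬ IsGood D :=
    fun D hD hnaked ↦ not_isGood_of_isNakedDatum hN hD hnaked
  -- the comb lemma's radius for this carrier
  obtain ⟨r₁, hr₁, hcomb⟩ := hL E T S μ r₀ hT0 hr₀ hT1 hTA hS hμ
  -- seeds on both sides at scale `r₁`, with the nakedness dictionary
  obtain ⟨σ₁, σ₂, ε₂, G₁, G₂, hε₂, hseeds, hdict⟩ := hseed r₁ hr₁
  -- the comb chart
  obtain ⟨ρ, hρ, Φ, K, hΦ0, hK0, hacc, hΦc, hsat⟩ := hcomb σ₁ σ₂ G₁ G₂ hseeds ε₂ hε₂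
  -- the family clause, with nakedness as conclusion
  have hfam : ∀ F : EuclideanSpace ℝ (Fin 1) → Literature.Geometry.Lorentzian.InitialDataSet (𝓡 3) X, Literature.Geometry.Lorentzian.InitialDataSet.IsSmoothDataFamily 1 F → F 0 = dstar → (∀ c, F c ∈ Literature.Geometry.Lorentzian.admissibleVacuumData X) → (∃ C : Set X, IsCompact C ∧ ∀ c, ∀ x ∉ C, (F c).h.inner x = dstar.h.inner x ∧ (F c).k x = dstar.k x) → ∃ δ : ℝ, 0 < δ ∧ ContinuousOn (fun c ↦ Φ (π (F c))) (Metric.ball 0 δ) ∧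
      ∀ c ∈ Metric.ball (0 : EuclideanSpace ℝ (Fin 1)) δ, Φ (π (F c)) ∈ K → IsNakedDatum (F c) := by
    intro F hF h0 hFadm hCpt
    obtain ⟨δ₁, hδ₁, hπc⟩ := hcont F hF h0 hFadm hCpt
    obtain ⟨δ₂, hδ₂, hnk⟩ := hdict F hF h0 hFadm hCpt
    -- `π ∘ F` is continuous at `0` and `π (F 0) = 0`, so small members are read inside `ball 0 ρ`
    have hat : ContinuousAt (fun c ↦ π (F c)) 0 :=
      (hπc 0 (Metric.mem_ball_self hδ₁)).continuousAt (Metric.ball_mem_nhds 0 hδ₁)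
    have h00 : π (F 0) = 0 := by rw [h0, hπ0]
    have hpre : (fun c ↦ π (F c)) ⁻¹' Metric.ball (0 : E × ℝ) ρ ∈ 𝓝 (0 : EuclideanSpace ℝ (Fin 1)) := by
      apply hat.preimage_mem_nhds
      rw [h00]
      exact Metric.ball_mem_nhds 0 hρ
    obtain ⟨δ₃, hδ₃, hball⟩ := Metric.mem_nhds_iff.1 hpre
    refine ⟨min δ₁ (min δ₂ δ₃), by positivity, ?_, ?_⟩
    · -- continuity: `Φ` on `ball 0 ρ` after `π ∘ F` on the small ball
      have hsub₁ : Metric.ball (0 : EuclideanSpace ℝ (Fin 1)) (min δ₁ (min δ₂ δ₃)) ⊆ Metric.ball 0 δ₁ :=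
        Metric.ball_subset_ball (min_le_left _ _)
      have hsub₃ : Metric.ball (0 : EuclideanSpace ℝ (Fin 1)) (min δ₁ (min δ₂ δ₃)) ⊆ Metric.ball 0 δ₃ :=
        (Metric.ball_subset_ball (min_le_right _ _)).trans (Metric.ball_subset_ball (min_le_right _ _))
      have hmaps : Set.MapsTo (fun c ↦ π (F c)) (Metric.ball (0 : EuclideanSpace ℝ (Fin 1)) (min δ₁ (min δ₂ δ₃)))
          (Metric.ball (0 : E × ℝ) ρ) := fun c hc ↦ hball (hsub₃ hc)
      exact hΦc.comp (hπc.mono hsub₁) hmaps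
    · intro c hc hK
      have hc₂ : c ∈ Metric.ball (0 : EuclideanSpace ℝ (Fin 1)) δ₂ :=
        (Metric.ball_subset_ball ((min_le_right _ _).trans (min_le_left _ _))) hc
      have hc₃ : c ∈ Metric.ball (0 : EuclideanSpace ℝ (Fin 1)) δ₃ :=
        (Metric.ball_subset_ball ((min_le_right _ _).trans (min_le_right _ _))) hc
      have hρc : π (F c) ∈ Metric.ball (0 : E × ℝ) ρ := hball hc₃
      exact hnk c hc₂ (hsat (π (F c)) hρc hK)
  refine ⟨X, i₁, i₂, i₃, i₄, i₅, i₆, dstar, fun D ↦ Φ (π D), K, hadm, ?_, ?_, ?_, ?_⟩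
  · -- `d⋆` is exceptional: saturation along the constant family through `d⋆`
    obtain ⟨δ, hδ, -, hnaked⟩ := hfam (fun _ ↦ dstar) (InitialDataSet.isSmoothDataFamily_const 1 dstar)
      rfl (fun _ ↦ hadm) ⟨∅, isCompact_empty, fun _ _ _ ↦ ⟨rfl, rfl⟩⟩
    have hmem : Φ (π dstar) ∈ K := by rw [hπ0, hΦ0]; exact hK0
    exact key dstar hadm (hnaked 0 (Metric.mem_ball_self hδ) hmem)
  · -- `Φ d⋆ ∈ K`
    show Φ (π dstar) ∈ K
    rw [hπ0, hΦ0]; exact hK0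
  · -- two-sided accumulation, transported along `Φ (π d⋆) = 0`
    intro ε hε
    show (K ∩ Set.Ioo (Φ (π dstar) - ε) (Φ (π dstar))).Nonempty ∧
      (K ∩ Set.Ioo (Φ (π dstar)) (Φ (π dstar) + ε)).Nonempty
    rw [hπ0, hΦ0]
    exact hacc ε hε
  · -- the family clause: nakedness converted into exceptionality
    intro F hF h0 hFadm hCpt
    obtain ⟨δ, hδ, hc, hnaked⟩ := hfam F hF h0 hFadm hCpt
    exact ⟨δ, hδ, hc, fun c hcδ hcK ↦ key (F c) (hFadm c) (hnaked c hcδ hcK)⟩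

/-! ### Consistency: each registered stub, stated EXPANDED, IS the named statement of §1. -/

theorem combLemma_holds : CombLemma := stub_combLemma
theorem vacuumCombCarrier_holds : VacuumCombCarrier := stub_vacuumCombCarrier
theorem nakedNotSettled_holds : NakedNotSettled := stub_nakedNotSettled

/-- **The crux from the skeleton** (closed modulo the three `sorry`s). [folklore] -/
theorem LaminatedThreshold_proof : LaminatedThreshold :=
  LaminatedThreshold_of stub_combLemma stub_vacuumCombCarrier stub_nakedNotSettled

/-! ### Sanity (no `sorry`): the derivative hypothesis of the comb lemma has the intended reading —
the linear model `T (x, t) = (S x, μ t)` satisfies it (anti-vacuity of the hypothesis shape). -/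

example (E : Type) [NormedAddCommGroup E] [NormedSpace ℝ E] (S : E →L[ℝ] E) (μ : ℝ) :
    HasFDerivAt (fun p : E × ℝ ↦ (S p.1, μ • p.2))
      ((S.comp (ContinuousLinearMap.fst ℝ E ℝ)).prod (μ • ContinuousLinearMap.snd ℝ E ℝ)) 0 := by
  have h : (fun p : E × ℝ ↦ (S p.1, μ • p.2)) =
      fun p ↦ ((S.comp (ContinuousLinearMap.fst ℝ E ℝ)).prod (μ • ContinuousLinearMap.snd ℝ E ℝ)) p := by
    funext p; simp
  rw [h]
  exact ContinuousLinearMap.hasFDerivAt _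

end Summit.FinalStateConjecture.FinalStateConjecture.Cruxes.LaminatedThreshold.HeteroclinicComb

end
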